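import Mathlib
import Summits.KontsevichZagierPeriods.Zeta5Search.ZeroEvaluationFraction
import HarnessLib

/-!
# ζ(5) search — ZERO EVALUATION is a THEOREM (gen-2 g7 §2.4)

Cell `pub-zeta5` (HONEST FRAMING: systematic search; no irrationality claim unless certified), typer seat
generation 8.  Discharges BY NAME `ClusterValuation.ZeroEvaluation` (found and proved on paper by gen-2 g7, REPORT-gen2-g7
§2.4; g8 check 1,779 classes): in the window `p² > b₀+2`, if the residue class of `x` has a SINGLE pole `q` and every class
point below `q` is a ZERO of `R_b` (no neutral point), then the class piece `V_x = Σ_o c_{o,q} H_q^{(o+1)}` of the constant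
term is `p`-integral — although `E_x` may be as low as `−6`.

PROOF (no `p`-adic analysis; everything in `ℚ[X]`; the fraction algebra is part 1, `ZeroEvaluationFraction.lean`).  Only the multiples `k = mp ≤ q` of `p` in `H_q^{(σ)} = Σ_{k ≤ q} k^{−σ}`
carry denominators, and for such `k` the point `u = q − k` lies in the class below `q`, so it is a zero.  With
`G = Gser b q` (regular part at the pole, `p`-INTEGRAL coefficients by `gser_integral` since `q` is alone in its class),
pole order `κ = 6 − mult q`, and the reduced fraction `Pden · G = Pnum` (`Pden` = the OTHER poles, all in foreign classes;
`Pnum` = centre factor × zeros), the truncation `T = (X^{mult q} G mod X^6)` satisfies `Pden·T − X^{mult q}·Pnum = X^6·H`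
with `H` `p`-integral; evaluating at `X = k` where `Pnum(k) = 0` (the zero `u`):
`Σ_o c_{o,q} k^{−(o+1)} = T(k)/k^6 = H(k)/Pden(k)` and `Pden(k) = ∏_{poles s'≠q} (s'−u)^{ord}` is a `p`-adic unit.
Identities of rational numbers; nothing about irrationality. (Re-filed after a gate-internal index.lock; third filing.)
-/

noncomputable section

open Finset PowerSeries

namespace Summit.KontsevichZagierPeriods.Zeta5Search.ClusterValuation

open Summit.KontsevichZagierPeriods.Zeta5Search.DualSeries (InBox)
open Summit.KontsevichZagierPeriods.Zeta5Search.WedgeDictionary (IsPFData pfData isPFData_pfData exists_isPFData)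
open Summit.KontsevichZagierPeriods.Zeta5Search.CasoratianValuation (InPolytope)
open Summit.KontsevichZagierPeriods.Zeta5Search.PadicSeries
open Literature.NumberTheory.Transcendental.BallRivoal (harm)

variable {p : ℕ} [hp : Fact p.Prime]

/-! ### Non-poles carry no partial-fraction coefficients; unique poles -/

omit hp in
/-- A regular point (`netExp s ≥ 0`) has `c_{o,s} = 0`. -/
theorem pfData_eq_zero_of_netExp_nonneg (b : ℕ → ℤ) (hb : InPolytope b) {s : ℕ} (hs : s ≤ (b 0).toNat)
    (hreg : 0 ≤ netExp b s) {o : ℕ} (ho : o < 6) : pfData b o s = 0 := by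
  obtain ⟨hbox, h2, h3⟩ := hb
  have hhalf : ∀ j ∈ range 7, 2 * b (j + 1) ≤ b 0 + 1 := fun j hj => by have := h2 j hj; omega
  obtain ⟨c, hc⟩ := exists_isPFData b hbox (by omega)
  have hid := pf_eq_coeff_Gser b hbox hhalf (isPFData_pfData hc) hs ho
  have hm := mult_eq_netExp b s
  rw [coeff_X_pow_mul', if_neg (by omega)] at hid
  exact hid

omit hp in
/-- In a class with exactly one pole `q`, every other class member is a non-pole. -/
theorem netExp_nonneg_of_unique_pole (b : ℕ → ℤ) {x q s : ℕ} (hcount : classPoleCount b p x = 1)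
    (hq : q ∈ classSet b p x) (hqpole : netExp b q < 0) (hs : s ∈ classSet b p x) (hsq : s ≠ q) :
    0 ≤ netExp b s := by
  by_contra hneg
  push Not at hneg
  have hsub : ({q, s} : Finset ℕ) ⊆ (classSet b p x).filter fun t => netExp b t < 0 := by
    intro t ht
    rw [mem_insert, mem_singleton] at ht
    rcases ht with rfl | rfl
    · exact mem_filter.2 ⟨hq, hqpole⟩
    · exact mem_filter.2 ⟨hs, hneg⟩
  have hcard := card_le_card hsub
  rw [card_pair (Ne.symm hsq)] at hcard
  unfold classPoleCount at hcount
  omega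

omit hp in
/-- Membership in a class through divisibility. -/
theorem mem_classSet_iff (b : ℕ → ℤ) (x s : ℕ) :
    s ∈ classSet b p x ↔ s ≤ (b 0).toNat ∧ (p : ℤ) ∣ (s : ℤ) - x := by
  simp only [classSet, mem_filter, mem_range, Nat.lt_succ_iff]
  have : (p : ℤ) ∣ (s : ℤ) - x ↔ s % p = x % p := by
    rw [dvd_sub_comm]; exact (Nat.modEq_iff_dvd).symm
  rw [this]

/-! ### Assembly -/

/-- `‖1/k^i‖_p = 1`… bounded by `1` when `p ∤ k`. -/
theorem padicNorm_inv_pow_le_one {k : ℕ} (hk : ¬ p ∣ k) (i : ℕ) : padicNorm p (1 / ((k : ℚ)) ^ i) ≤ 1 := by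
  have h1 : padicNorm p (k : ℚ) = 1 := by exact_mod_cast (padicNorm.nat_eq_one_iff (p := p) k).2 hk
  have : padicNorm p (((k : ℚ)) ^ i) = 1 := by
    induction i with
    | zero => simp
    | succ m ih => rw [pow_succ, padicNorm.mul, ih, h1, one_mul]
  rw [padicNorm.div, this, padicNorm.one, div_one]

/-- **ZERO EVALUATION is a THEOREM** (gen-2 g7 §2.4): a single-pole class whose lower points are all zeros has a
`p`-integral constant-term piece `V_x`. -/
theorem zeroEvaluation_holds : ZeroEvaluation := by
  intro b p x q hb hprime hp5 hwin _hx hcount hq hqpole hzeros hne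
  haveI : Fact p.Prime := ⟨hprime⟩
  obtain ⟨hbox, -, -, hn⟩ := thmA_data b hb hwin
  have hp2 : p ≠ 2 := by omega
  have hqn : q ≤ (b 0).toNat := ((mem_classSet_iff b x q).1 hq).1
  have hqx : (p : ℤ) ∣ (q : ℤ) - x := ((mem_classSet_iff b x q).1 hq).2
  -- the other class members are non-poles
  have hreg : ∀ s, s ≤ (b 0).toNat → s ≠ q → (p : ℤ) ∣ (s : ℤ) - q → 6 ≤ mult b s := by
    intro s hs hsq hdvd
    have hsx : s ∈ classSet b p x := (mem_classSet_iff b x s).2 ⟨hs, by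
      have := hdvd.add hqx
      have e : (s : ℤ) - q + ((q : ℤ) - x) = (s : ℤ) - x := by ring
      rwa [e] at this⟩
    have := netExp_nonneg_of_unique_pole b hcount hq hqpole hsx hsq
    have := mult_eq_netExp b s
    omega
  -- Step a: only the pole contributes
  have hV : classV b p x = ∑ o ∈ range 6, pfData b o q * harm (o + 1) q := by
    unfold classV
    refine sum_eq_single_of_mem q hq fun s hs hsq => sum_eq_zero fun o ho => ?_
    have hsn : s ≤ (b 0).toNat := ((mem_classSet_iff b x s).1 hs).1
    rw [pfData_eq_zero_of_netExp_nonneg b hb hsn (netExp_nonneg_of_unique_pole b hcount hq hqpole hs hsq)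
      (mem_range.1 ho), zero_mul]
  -- Step b: split the harmonic sums at the multiples of `p`
  have hsplit : ∑ o ∈ range 6, pfData b o q * harm (o + 1) q =
      ∑ o ∈ range 6, pfData b o q * (∑ m ∈ (range q).filter (fun m => ¬ p ∣ m + 1), 1 / ((m : ℚ) + 1) ^ (o + 1)) +
      ∑ m ∈ (range q).filter (fun m => p ∣ m + 1), ∑ o ∈ range 6, pfData b o q / (((m + 1 : ℕ) : ℚ)) ^ (o + 1) := by
    rw [sum_comm (s := (range q).filter _), ← sum_add_distrib]
    refine sum_congr rfl fun o _ => ?_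
    rw [harm, ← sum_filter_add_sum_filter_not (range q) (fun m => p ∣ m + 1), mul_add, add_comm]
    congr 1
    rw [mul_sum]
    refine sum_congr rfl fun m _ => ?_
    push_cast; ring
  -- Step c: every piece is `p`-integral
  have hint : padicNorm p (classV b p x) ≤ 1 := by
    rw [hV, hsplit]
    refine (padicNorm.nonarchimedean (p := p)).trans (max_le ?_ ?_)
    · refine padicNorm.sum_le' (fun o ho => ?_) zero_le_one
      have ho' := mem_range.1 ho
      rw [padicNorm.mul]
      have hc : padicNorm p (pfData b o q) ≤ 1 := by
        by_cases h0 : pfData b o q = 0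
        · rw [h0, padicNorm.zero]; exact zero_le_one
        · have hcq : classPoleCount b p q = 1 := by
            unfold classPoleCount; rw [classSet_eq_of_mem hq]; exact hcount
          have hv := isolatedPoleIntegral_holds b p q o hb hprime (by omega) hwin hqn ho' h0 hcq
          rw [padicNorm.eq_zpow_of_nonzero h0]
          exact zpow_le_one_of_nonpos₀ one_le_p (by linarith)
      have hA : padicNorm p (∑ m ∈ (range q).filter (fun m => ¬ p ∣ m + 1), 1 / ((m : ℚ) + 1) ^ (o + 1)) ≤ 1 := by
        refine padicNorm.sum_le' (fun m hm => ?_) zero_le_one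
        have hm' := (mem_filter.1 hm).2
        have := padicNorm_inv_pow_le_one (p := p) hm' (o + 1)
        push_cast at this
        exact this
      calc padicNorm p (pfData b o q) * padicNorm p _ ≤ 1 * 1 := mul_le_mul hc hA (padicNorm.nonneg _) zero_le_one
        _ = 1 := one_mul _
    · refine padicNorm.sum_le' (fun m hm => ?_) zero_le_one
      obtain ⟨hmq, hpm⟩ := mem_filter.1 hm
      have hmq' := mem_range.1 hmq
      refine padicNorm_polar_le_one b hb hqn hn hp2 (by omega) (by omega) (by exact_mod_cast hpm) ?_ hreg
      -- `u = q - (m+1)` is a class point below `q`, hence a zero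
      set u := q - (m + 1) with hu
      have hun : u ≤ (b 0).toNat := by omega
      have hux : u ∈ classSet b p x := (mem_classSet_iff b x u).2 ⟨hun, by
        have h1 : (p : ℤ) ∣ ((m + 1 : ℕ) : ℤ) := by exact_mod_cast hpm
        have e : (u : ℤ) - x = ((q : ℤ) - x) - ((m + 1 : ℕ) : ℤ) := by push_cast; omega
        rw [e]; exact hqx.sub h1⟩
      have huq : u ≠ q := by omega
      have h1 := netExp_nonneg_of_unique_pole b hcount hq hqpole hux huq
      have h2 := hzeros u hux (by omega)
      have h3 := mult_eq_netExp b u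
      omega
  rw [padicNorm.eq_zpow_of_nonzero hne] at hint
  have : -padicValRat p (classV b p x) ≤ 0 := by
    rw [← zpow_le_zpow_iff_right₀ (one_lt_p (p := p)), zpow_zero]; exact hint
  linarith

end Summit.KontsevichZagierPeriods.Zeta5Search.ClusterValuation

end
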